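import Summits.QuantumFields.BalabanUV.T4Continuum.Spine.NE1p.B7AveragingWordCommutator

/-!
# T⁴ programme, spine estimate NE1′ (node O3b/H2) — towards the ITERATE (43): the second-order `log`-calculus of §R56∕R57 for
# GENERAL bond curves (not only one-parameter groups) — the INVERSE letter `U(−b) = U(b)⁻¹`

Cell `pub-balaban-gaps` (YM blitz Y1, track G2), seat `ne1` gen 9 (prover-pub-balaban-gaps-ne1-g9-0); record `HOME/ne/NE1.md` v9 §6 (xvii)
(successor door (b): «the same second-order computation for the ITERATE (43)» — its input at level `j+1` is no longer `e^{tA}`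
but a general curve of configurations through `1`, read through (9) with inverted letters).  ADDITIVE — imports this seat's
`B7AveragingWordCommutator` (gen 9; through it `B7AveragingLogProductCommutator`'s `iteratedDeriv_two_mlog_comp`) and Mathlib's
`hasFDerivAt_ringInverse`, and the lineages' `B7Prop1Explicit` (`hol`, `stepHol`, `stepA`, `asum`) ∕ `B8Ineq130.hol_one` BY NAME; 0 def.

WHAT THIS FILE PROVES ([folklore]; 0 sorry).  In a complete normed ℂ-algebra, for a units-valued curve `γ` with `γ(0) = 1`,
derivative `γ₁` (`∀ t`) and `γ₁′(0) = w`: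
* `derivData_units_inv` — derivative data of the INVERSE curve `t ↦ γ(t)⁻¹`: derivative `−γ⁻¹ γ₁ γ⁻¹` at every `t` (Mathlib
  `hasFDerivAt_ringInverse`), that function's derivative at `0` is `2γ₁(0)² − w`, and its value at `0` is `−γ₁(0)`;
* **`iteratedDeriv_two_mlog_units_inv` — `d²/dt²|₀ log γ(t)⁻¹ = −d²/dt²|₀ log γ(t)`** (both `= ∓(w − γ₁(0)²)`): the reversed
  letter of (9) contributes MINUS the `log`-curvature of the bond curve and MINUS its velocity — exactly the sign rule of the
  abelian path functional (`stepA`), now for curvatures too.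
* §3 — the WORD RECURSION ALONG A GENERAL CONFIGURATION CURVE `V(t)` through `1` (bondwise derivative data `V₁`, `W`):
  letter data (`exists_derivData_stepHol`), word data with velocity `A(Γ)` for `A = V₁(0)` (`exists_derivData_hol_curve`),
  **`iteratedDeriv_two_mlog_hol_curve_cons`: `κ(b :: Γ) = κ(letter curve) + κ(Γ) + [stepA(V₁(0))(b), A(Γ)]`**, and the
  reversed letter `κ(V(t)(−b)) = −κ(V(t)(b))` (`iteratedDeriv_two_mlog_stepHol_false`) — the form the ITERATE (43) consumes
  (its input at level `j+1` is the level-`j` output curve, not `e^{tA}`).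
* **`iteratedDeriv_two_mlog_bavg_curve` — ONE AVERAGING STEP (42) ALONG A GENERAL CONFIGURATION CURVE**: the cross-term
  formula of file 8 verbatim with `A = V₁(0)` and the general-curve `κ`'s — the induction step of the ITERATE (43).
What it does NOT do: the rescaling ∕ reindexing bookkeeping of (43) (`B7Prop2Explicit.avgIter`, `rescale`) and the bondwise
derivative data of the averaged curve itself (needed to feed the next level); any estimate.

HONEST FRAMING.  [folklore] calculus; nothing of Bałaban's asserted; NE1′ NOT proved; spine 0∕9; (B) 0∕13; binders 0∕6; one fixed
finite T⁴ — NOT ℝ⁴, NOT infinite volume, NOT a mass gap, NOT Clay.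
-/

noncomputable section

open scoped Topology
open NormedSpace Filter

namespace Summit.QuantumFields.BalabanUV.T4Continuum.NE1p.B7AveragingCommutator

open Literature.MathematicalPhysics.QuantumFieldTheory.Balaban1983to89.MatrixLog (mlog)

variable {𝔸 : Type*} [NormedRing 𝔸] [NormedAlgebra ℂ 𝔸] [CompleteSpace 𝔸]

/-- **Derivative data of the inverse curve.**  For a units-valued curve `γ` with `γ(0) = 1`, derivative `γ₁(t)` at every `t`
and `γ₁′(0) = w`: `(γ⁻¹)′(t) = −γ(t)⁻¹ γ₁(t) γ(t)⁻¹` (Mathlib `hasFDerivAt_ringInverse`), this derivative function has derivative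
`γ₁(0)² + γ₁(0)² − w` at `0`, and its value at `0` is `−γ₁(0)`. [folklore] -/
theorem derivData_units_inv {γ : ℂ → 𝔸ˣ} {γ₁ : ℂ → 𝔸} {w : 𝔸} (h0 : γ 0 = 1)
    (hγ : ∀ t : ℂ, HasDerivAt (fun u : ℂ => ((γ u : 𝔸ˣ) : 𝔸)) (γ₁ t) t) (hγ₁ : HasDerivAt γ₁ w 0) :
    (∀ t : ℂ, HasDerivAt (fun u : ℂ => (((γ u)⁻¹ : 𝔸ˣ) : 𝔸))
        (-((((γ t)⁻¹ : 𝔸ˣ) : 𝔸) * γ₁ t * (((γ t)⁻¹ : 𝔸ˣ) : 𝔸))) t)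
      ∧ HasDerivAt (fun t : ℂ => -((((γ t)⁻¹ : 𝔸ˣ) : 𝔸) * γ₁ t * (((γ t)⁻¹ : 𝔸ˣ) : 𝔸)))
          (γ₁ 0 * γ₁ 0 + γ₁ 0 * γ₁ 0 - w) 0
      ∧ -((((γ 0)⁻¹ : 𝔸ˣ) : 𝔸) * γ₁ 0 * (((γ 0)⁻¹ : 𝔸ˣ) : 𝔸)) = -γ₁ 0 := by
  have hinv : ∀ t : ℂ, HasDerivAt (fun u : ℂ => (((γ u)⁻¹ : 𝔸ˣ) : 𝔸))
      (-((((γ t)⁻¹ : 𝔸ˣ) : 𝔸) * γ₁ t * (((γ t)⁻¹ : 𝔸ˣ) : 𝔸))) t := by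
    intro t
    have e : (fun u : ℂ => (((γ u)⁻¹ : 𝔸ˣ) : 𝔸)) = fun u : ℂ => Ring.inverse ((γ u : 𝔸ˣ) : 𝔸) := by
      funext u; rw [Ring.inverse_unit]
    rw [e]
    have h := (hasFDerivAt_ringInverse (𝕜 := ℂ) (γ t)).comp_hasDerivAt t (hγ t)
    simpa [Function.comp_def] using h
  refine ⟨hinv, ?_, ?_⟩
  · have h1 : HasDerivAt (fun t : ℂ => (((γ t)⁻¹ : 𝔸ˣ) : 𝔸) * γ₁ t * (((γ t)⁻¹ : 𝔸ˣ) : 𝔸))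
        (-((((γ 0)⁻¹ : 𝔸ˣ) : 𝔸) * γ₁ 0 * (((γ 0)⁻¹ : 𝔸ˣ) : 𝔸)) * γ₁ 0 * (((γ 0)⁻¹ : 𝔸ˣ) : 𝔸)
          + (((γ 0)⁻¹ : 𝔸ˣ) : 𝔸) * w * (((γ 0)⁻¹ : 𝔸ˣ) : 𝔸)
          + (((γ 0)⁻¹ : 𝔸ˣ) : 𝔸) * γ₁ 0 * -((((γ 0)⁻¹ : 𝔸ˣ) : 𝔸) * γ₁ 0 * (((γ 0)⁻¹ : 𝔸ˣ) : 𝔸))) 0 := by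
      have := ((hinv 0).fun_mul hγ₁).fun_mul (hinv 0)
      simpa [add_mul] using this
    have h2 := h1.fun_neg
    rw [h0] at h2
    simp only [inv_one, Units.val_one, one_mul, mul_one] at h2
    have e : -(-γ₁ 0 * γ₁ 0 + w + γ₁ 0 * -γ₁ 0) = γ₁ 0 * γ₁ 0 + γ₁ 0 * γ₁ 0 - w := by noncomm_ring
    rw [e] at h2
    exact h2
  · rw [h0]; simp

/-- **`d²/dt²|₀ log γ(t)⁻¹ = −d²/dt²|₀ log γ(t)`**: the `log`-curvature of the inverse curve is minus that of the curve (both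
computed by the second-order chain rule `iteratedDeriv_two_mlog_comp`: `(2v² − w) − (−v)² = −(w − v²)`, `v = γ₁(0)`) — the
reversed-letter rule of (9) at second order. [cite: Balaban1985Averaging, (9) p.18, (21) p.21] -/
theorem iteratedDeriv_two_mlog_units_inv {γ : ℂ → 𝔸ˣ} {γ₁ : ℂ → 𝔸} {w : 𝔸} (h0 : γ 0 = 1)
    (hγ : ∀ t : ℂ, HasDerivAt (fun u : ℂ => ((γ u : 𝔸ˣ) : 𝔸)) (γ₁ t) t) (hγ₁ : HasDerivAt γ₁ w 0) :
    iteratedDeriv 2 (fun t : ℂ => mlog (((γ t)⁻¹ : 𝔸ˣ) : 𝔸)) 0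
      = -iteratedDeriv 2 (fun t : ℂ => mlog ((γ t : 𝔸ˣ) : 𝔸)) 0 := by
  obtain ⟨hI, hI₁, hI0⟩ := derivData_units_inv h0 hγ hγ₁
  rw [iteratedDeriv_two_mlog_comp (γ := fun t : ℂ => (((γ t)⁻¹ : 𝔸ˣ) : 𝔸)) (by simp [h0])
      (Filter.Eventually.of_forall hI) hI₁,
    iteratedDeriv_two_mlog_comp (γ := fun t : ℂ => ((γ t : 𝔸ˣ) : 𝔸)) (by simp [h0])
      (Filter.Eventually.of_forall hγ) hγ₁, hI0]
  noncomm_ring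

/-! ## §3 The word recursion for a GENERAL configuration curve `V(t)` through `1` -/

section Curve

open Literature.MathematicalPhysics.QuantumFieldTheory.Balaban1983to89.B7Prop1Explicit
open Literature.MathematicalPhysics.QuantumFieldTheory.Balaban1983to89.B8Ineq130 (hol_one)

variable {d : ℕ} {V : ℂ → Site d → Fin d → 𝔸ˣ} {V₁ : ℂ → Site d → Fin d → 𝔸} {W : Site d → Fin d → 𝔸}
  (h0 : V 0 = 1) (hV : ∀ (y : Site d) (μ : Fin d) (t : ℂ), HasDerivAt (fun u : ℂ => ((V u y μ : 𝔸ˣ) : 𝔸)) (V₁ t y μ) t)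
  (hV₁ : ∀ (y : Site d) (μ : Fin d), HasDerivAt (fun t : ℂ => V₁ t y μ) (W y μ) 0)

include h0 hV hV₁

/-- Derivative data of ONE LETTER of (9) along a configuration curve `V(t)` through `1` (bondwise derivatives `V₁`, second
derivatives `W` at `0`): for `+b` the bond curve itself, for `−b` its inverse (`derivData_units_inv`); in both cases the velocity
at `0` is the SIGNED bond velocity `stepA (V₁ 0)`. [cite: Balaban1985Averaging, (9) p.18] -/
theorem exists_derivData_stepHol (x : Site d) (l : Letter d) :
    ∃ α₁ : ℂ → 𝔸, ∃ wa : 𝔸, (∀ t : ℂ, HasDerivAt (fun u : ℂ => ((stepHol (V u) x l : 𝔸ˣ) : 𝔸)) (α₁ t) t)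
      ∧ HasDerivAt α₁ wa 0 ∧ α₁ 0 = stepA (V₁ 0) x l := by
  obtain ⟨μ, b⟩ := l
  cases b
  · obtain ⟨hI, hI₁, hI0⟩ := derivData_units_inv (γ := fun t : ℂ => V t (x - e μ) μ) (by simp [h0]) (hV (x - e μ) μ)
      (hV₁ (x - e μ) μ)
    refine ⟨_, _, fun t => ?_, hI₁, by rw [hI0, stepA_false]⟩
    have e1 : (fun u : ℂ => ((stepHol (V u) x (μ, false) : 𝔸ˣ) : 𝔸)) = fun u : ℂ => (((V u (x - e μ) μ)⁻¹ : 𝔸ˣ) : 𝔸) := by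
      funext u; rw [stepHol_false]
    rw [e1]; exact hI t
  · refine ⟨fun t => V₁ t x μ, W x μ, fun t => ?_, hV₁ x μ, by rw [stepA_true]⟩
    have e1 : (fun u : ℂ => ((stepHol (V u) x (μ, true) : 𝔸ˣ) : 𝔸)) = fun u : ℂ => ((V u x μ : 𝔸ˣ) : 𝔸) := by
      funext u; rw [stepHol_true]
    rw [e1]; exact hV x μ t

omit [NormedAlgebra ℂ 𝔸] [CompleteSpace 𝔸] hV hV₁ in
/-- A letter of the unit configuration is `1`: `stepHol (V 0) x l = 1`. [folklore] -/
theorem val_stepHol_curve_zero (x : Site d) (l : Letter d) : ((stepHol (V 0) x l : 𝔸ˣ) : 𝔸) = 1 := by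
  obtain ⟨μ, b⟩ := l
  cases b
  · rw [stepHol_false, h0]; simp
  · rw [stepHol_true, h0]; simp

/-- **Derivative data of the word transport along a general configuration curve**: `t ↦ V(t)(Γ)` has a derivative at every
`t`, differentiable again at `0`, with velocity the SIGNED SUM of bond velocities `A(Γ)` for `A = V₁(0)` (the lineage's `asum`).
[cite: Balaban1985Averaging, (9) p.18, p.25] -/
theorem exists_derivData_hol_curve :
    ∀ (w : List (Letter d)) (x : Site d), ∃ γ₁ : ℂ → 𝔸, ∃ w₂ : 𝔸,
      (∀ t : ℂ, HasDerivAt (fun u : ℂ => ((hol (V u) x w : 𝔸ˣ) : 𝔸)) (γ₁ t) t)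
        ∧ HasDerivAt γ₁ w₂ 0 ∧ γ₁ 0 = asum (V₁ 0) x w
  | [], x => by
    refine ⟨fun _ => 0, 0, fun t => ?_, hasDerivAt_const (0 : ℂ) (0 : 𝔸), by simp⟩
    simpa using hasDerivAt_const t (1 : 𝔸)
  | l :: w, x => by
    obtain ⟨α₁, wa, hα, hα₁, hα0⟩ := exists_derivData_stepHol h0 hV hV₁ x l
    obtain ⟨β₁, wb, hβ, hβ₁, hβ0⟩ := exists_derivData_hol_curve w (x + l.vec)
    refine ⟨fun t => α₁ t * ((hol (V t) (x + l.vec) w : 𝔸ˣ) : 𝔸) + ((stepHol (V t) x l : 𝔸ˣ) : 𝔸) * β₁ t,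
      wa * ((hol (V 0) (x + l.vec) w : 𝔸ˣ) : 𝔸) + α₁ 0 * β₁ 0 + (α₁ 0 * β₁ 0 + ((stepHol (V 0) x l : 𝔸ˣ) : 𝔸) * wb),
      fun t => ?_, ?_, ?_⟩
    · have e1 : (fun u : ℂ => ((hol (V u) x (l :: w) : 𝔸ˣ) : 𝔸))
          = fun u : ℂ => ((stepHol (V u) x l : 𝔸ˣ) : 𝔸) * ((hol (V u) (x + l.vec) w : 𝔸ˣ) : 𝔸) := by
        funext u; rw [hol_cons, Units.val_mul]
      rw [e1]; exact (hα t).fun_mul (hβ t)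
    · exact (hα₁.fun_mul (hβ 0)).fun_add ((hα 0).fun_mul hβ₁)
    · dsimp only
      rw [asum_cons, hα0, hβ0, val_stepHol_curve_zero h0, one_mul, h0, hol_one, Units.val_one, mul_one]

/-- **THE WORD RECURSION ALONG A GENERAL CONFIGURATION CURVE** (the form the ITERATE (43) needs, its input at each level being
the previous level's output curve): with `κ(Γ) := d²/dt²|₀ log V(t)(Γ)`,
`κ(b :: Γ) = κ(the letter curve V(t)(±b)) + κ(Γ) + [stepA(V₁(0))(b), A(Γ)]`, `A = V₁(0)` — the composition law with the
letter's and the tail's derivative data; for a reversed letter `κ(V(t)(b)⁻¹) = −κ(V(t)(b))` by `iteratedDeriv_two_mlog_units_inv`.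
[cite: Balaban1985Averaging, (9) p.18, (21) p.21, (43) p.24] -/
theorem iteratedDeriv_two_mlog_hol_curve_cons (x : Site d) (l : Letter d) (w : List (Letter d)) :
    iteratedDeriv 2 (fun t : ℂ => mlog ((hol (V t) x (l :: w) : 𝔸ˣ) : 𝔸)) 0
      = iteratedDeriv 2 (fun t : ℂ => mlog ((stepHol (V t) x l : 𝔸ˣ) : 𝔸)) 0
        + iteratedDeriv 2 (fun t : ℂ => mlog ((hol (V t) (x + l.vec) w : 𝔸ˣ) : 𝔸)) 0
        + (stepA (V₁ 0) x l * asum (V₁ 0) (x + l.vec) w - asum (V₁ 0) (x + l.vec) w * stepA (V₁ 0) x l) := by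
  obtain ⟨α₁, wa, hα, hα₁, hα0⟩ := exists_derivData_stepHol h0 hV hV₁ x l
  obtain ⟨β₁, wb, hβ, hβ₁, hβ0⟩ := exists_derivData_hol_curve h0 hV hV₁ w (x + l.vec)
  have e1 : (fun t : ℂ => mlog ((hol (V t) x (l :: w) : 𝔸ˣ) : 𝔸))
      = fun t : ℂ => mlog (((stepHol (V t) x l : 𝔸ˣ) : 𝔸) * ((hol (V t) (x + l.vec) w : 𝔸ˣ) : 𝔸)) := by
    funext t; rw [hol_cons, Units.val_mul]
  have hb0 : ((hol (V 0) (x + l.vec) w : 𝔸ˣ) : 𝔸) = 1 := by rw [h0, hol_one, Units.val_one]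
  rw [e1, iteratedDeriv_two_mlog_mul (val_stepHol_curve_zero h0 x l) hb0 (Filter.Eventually.of_forall hα)
      (Filter.Eventually.of_forall hβ) hα₁ hβ₁, hα0, hβ0]

/-- The reversed letter: `d²/dt²|₀ log V(t)(−b) = −d²/dt²|₀ log V(t)(b)`. [cite: Balaban1985Averaging, (9) p.18] -/
theorem iteratedDeriv_two_mlog_stepHol_false (x : Site d) (μ : Fin d) :
    iteratedDeriv 2 (fun t : ℂ => mlog ((stepHol (V t) x (μ, false) : 𝔸ˣ) : 𝔸)) 0
      = -iteratedDeriv 2 (fun t : ℂ => mlog ((V t (x - e μ) μ : 𝔸ˣ) : 𝔸)) 0 := by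
  have e1 : (fun t : ℂ => mlog ((stepHol (V t) x (μ, false) : 𝔸ˣ) : 𝔸))
      = fun t : ℂ => mlog (((V t (x - e μ) μ)⁻¹ : 𝔸ˣ) : 𝔸) := by
    funext t; rw [stepHol_false]
  rw [e1]
  exact iteratedDeriv_two_mlog_units_inv (γ := fun t : ℂ => V t (x - e μ) μ) (by simp [h0]) (hV (x - e μ) μ)
    (hV₁ (x - e μ) μ)

omit h0 hV hV₁ in
/-- (42) unfolded along a general configuration curve: `Ū_c(V(t)) = exp[Σ_x L^{−d} log V(t)(Γ_{c,x} ∪ (−Γ_c))]·V(t)(Γ_c)`.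
[cite: Balaban1985Averaging, (42) p.23, (15) p.19] -/
theorem val_bavg_curve_eq (L : ℕ) (q : Site d) (κ : Fin d) (t : ℂ) :
    ((bavg L (V t) q κ : 𝔸ˣ) : 𝔸)
      = exp (∑ r : Fin d → Fin L, (((L : ℝ) ^ d)⁻¹) •
            mlog ((hol (V t) q (gammaWord L κ (boxVec L r) ++ seg κ (-(L : ℤ))) : 𝔸ˣ) : 𝔸))
        * ((hol (V t) q (seg κ L) : 𝔸ˣ) : 𝔸) := by
  show (((expUnit (Xavg L (V t) q κ) * hol (V t) q (seg κ L) : 𝔸ˣ)) : 𝔸) = _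
  rw [Units.val_mul, val_expUnit]
  unfold Xavg
  simp only [Wcx_eq_hol_loop]

/-- **ONE AVERAGING STEP ALONG A GENERAL CONFIGURATION CURVE — the induction step of the ITERATE (43)**: for a configuration
curve `V(t)` through `1` with bondwise derivative data (`V₁`, `W`) and every `L`-bond `c = ⟨q, q + Le_κ⟩`,
`d²/dt²|₀ log Ū_c(V(t)) = Σ_x L^{−d}·κ(Γ_{c,x} ∪ (−Γ_c)) + κ(Γ_c) + [X̂_c(A), A(Γ_c)]` with `κ(Γ) := d²/dt²|₀ log V(t)(Γ)`
(the general word recursion `iteratedDeriv_two_mlog_hol_curve_cons` unfolds each `κ`) and `A = V₁(0)` — verbatim the `e^{tA}`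
statement of `iteratedDeriv_two_mlog_bavg_expCfg`, now applicable with `V(t)` = the previous level's averaged curve.
[cite: Balaban1985Averaging, (42)–(43) pp.23–24, (15) p.19] -/
theorem iteratedDeriv_two_mlog_bavg_curve (L : ℕ) (q : Site d) (κ : Fin d) :
    iteratedDeriv 2 (fun t : ℂ => mlog ((bavg L (V t) q κ : 𝔸ˣ) : 𝔸)) 0
      = (∑ r : Fin d → Fin L, (((L : ℝ) ^ d)⁻¹) •
            iteratedDeriv 2 (fun t : ℂ =>
              mlog ((hol (V t) q (gammaWord L κ (boxVec L r) ++ seg κ (-(L : ℤ))) : 𝔸ˣ) : 𝔸)) 0)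
        + iteratedDeriv 2 (fun t : ℂ => mlog ((hol (V t) q (seg κ L) : 𝔸ˣ) : 𝔸)) 0
        + (Xhat L (V₁ 0) q κ * asum (V₁ 0) q (seg κ L) - asum (V₁ 0) q (seg κ L) * Xhat L (V₁ 0) q κ) := by
  have hw0 : ∀ w : List (Letter d), ((hol (V 0) q w : 𝔸ˣ) : 𝔸) = 1 := fun w => by rw [h0, hol_one, Units.val_one]
  have hdata : ∀ r : Fin d → Fin L, ∃ F : ℂ → 𝔸, ∃ κ₂ : 𝔸,
      (∀ᶠ t in 𝓝 (0 : ℂ), HasDerivAt (fun u : ℂ =>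
          mlog ((hol (V u) q (gammaWord L κ (boxVec L r) ++ seg κ (-(L : ℤ))) : 𝔸ˣ) : 𝔸)) (F t) t)
        ∧ HasDerivAt F κ₂ 0
        ∧ F 0 = asum (V₁ 0) q (gammaWord L κ (boxVec L r) ++ seg κ (-(L : ℤ)))
        ∧ κ₂ = iteratedDeriv 2 (fun t : ℂ =>
              mlog ((hol (V t) q (gammaWord L κ (boxVec L r) ++ seg κ (-(L : ℤ))) : 𝔸ˣ) : 𝔸)) 0 := by
    intro r
    obtain ⟨γ₁, w₂, hγ, hγ₁, hγ0⟩ := exists_derivData_hol_curve h0 hV hV₁ (gammaWord L κ (boxVec L r) ++ seg κ (-(L : ℤ))) q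
    obtain ⟨hF, hF', hF0⟩ := derivData_mlog_comp (hw0 _) (Filter.Eventually.of_forall hγ) hγ₁
    refine ⟨_, _, hF, hF', by rw [hF0, hγ0], ?_⟩
    rw [iteratedDeriv_two_mlog_comp (hw0 _) (Filter.Eventually.of_forall hγ) hγ₁]
  choose F κ₂ hF hF' hF0 hκ₂ using hdata
  set c : ℝ := ((L : ℝ) ^ d)⁻¹ with hc
  have hP : ∀ᶠ t in 𝓝 (0 : ℂ), HasDerivAt (fun u : ℂ => ∑ r : Fin d → Fin L, c •
      mlog ((hol (V u) q (gammaWord L κ (boxVec L r) ++ seg κ (-(L : ℤ))) : 𝔸ˣ) : 𝔸))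
      (∑ r : Fin d → Fin L, c • F r t) t := by
    have hall : ∀ᶠ t in 𝓝 (0 : ℂ), ∀ r : Fin d → Fin L, HasDerivAt (fun u : ℂ =>
        mlog ((hol (V u) q (gammaWord L κ (boxVec L r) ++ seg κ (-(L : ℤ))) : 𝔸ˣ) : 𝔸)) (F r t) t :=
      Filter.eventually_all.2 hF
    filter_upwards [hall] with t ht
    exact HasDerivAt.fun_sum fun r _ => (ht r).const_smul c
  have hP₁ : HasDerivAt (fun t : ℂ => ∑ r : Fin d → Fin L, c • F r t) (∑ r : Fin d → Fin L, c • κ₂ r) 0 :=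
    HasDerivAt.fun_sum fun r _ => (hF' r).const_smul c
  have hP0 : (∑ r : Fin d → Fin L, c •
      mlog ((hol (V 0) q (gammaWord L κ (boxVec L r) ++ seg κ (-(L : ℤ))) : 𝔸ˣ) : 𝔸)) = 0 := by
    simp [hw0]
  obtain ⟨β₁, wb, hβ, hβ₁, hβ0⟩ := exists_derivData_hol_curve h0 hV hV₁ (seg κ L) q
  have e : (fun t : ℂ => mlog ((bavg L (V t) q κ : 𝔸ˣ) : 𝔸))
      = fun t : ℂ => mlog (exp (∑ r : Fin d → Fin L, c •
          mlog ((hol (V t) q (gammaWord L κ (boxVec L r) ++ seg κ (-(L : ℤ))) : 𝔸ˣ) : 𝔸))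
          * ((hol (V t) q (seg κ L) : 𝔸ˣ) : 𝔸)) := by
    funext t; rw [val_bavg_curve_eq]
  rw [e, iteratedDeriv_two_mlog_exp_mul hP0 hP hP₁ (hw0 _) (Filter.Eventually.of_forall hβ) hβ₁, hβ0]
  simp only [hF0, hκ₂]
  unfold Xhat
  rfl

end Curve

end Summit.QuantumFields.BalabanUV.T4Continuum.NE1p.B7AveragingCommutator

end
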